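import Literature.IUT.HodgeTheaters.PMBaseIsoTorsorTwisted
import Literature.IUT.HodgeTheaters.PMBaseEx63EquivariantSchemaClosure

/-!
# [IUTchI] Prop 6.6 (ii) `DThetaEllBridge.IsoTorsor` over a kit: the EXACT side condition (FACT-LIST F-2018)

S. Mochizuki, *Inter-universal Teichmüller theory I: construction of Hodge theaters*, §6, Example 6.3 (i),
(ii) pp. 160–161, Proposition 6.6 (ii) p. 165, Proposition 6.8 (i) pp. 167–168 of the kurims manuscript (May
2020) [claim: Mochizuki2012, status: disputed].  PROOF-ONLY companion (theorems, no definitions) of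
abc-iut-L5-t4's `PMBaseBridgeProps.lean` (abc-iut cell, block F fact-proving wave, seat abc-iut-f-071 gen 4;
FACT-LIST row F-2018 `IsoTorsor`, Prop 6.6 (ii): exact side condition, second half).

Kernel verdict of record for F-2018 (ii) over ABSTRACT data (f-071 gen 3, `PMBaseIsoTorsorSchemaClosure.lean`):
universal closure REFUTED, instance form PROVED under (β) = `Ex63.NegCompatModel K`.  This file CLOSES the gap
between the two:

* `DThetaEllBridge.twistedNegCompat_of_isoTorsor_model` — Prop 6.6 (ii) for the pair (model bridge, model
  bridge) of Example 6.3 (i) ALREADY forces the twisted `[−1]`-compatibility: reading the compatibility square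
  of an automorphism with index bijection `t ↦ −t` at the label `t = 0` gives, at every `v`, a negative
  automorphism `a_v` of `𝒟_v` with `a_v ≫ φ^{Θell}_{•,v} = φ^{Θell}_{•,v} ≫ b`, `b = ψ ∘ (csp)` where `ψ` is the
  global constituent — ONE `b ∈ Aut_±(𝒟^{⊚±})` for all `v`, acting on `LabCusp^±(𝒟^{⊚±})` by `G ↦ −G + d` in the
  fixed chart (the positive alternative for `a_v` would make `LabCusp^±(ψ)` trivial, and then the square at
  `t = 1` reads `1 = −1` in `𝔽_l`);
* `DThetaEllBridge.forall_isoTorsor_iff_twistedNegCompat` — **the exact side condition**: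
  `(∀ B₁ B₂, IsoTorsor B₁ B₂) ↔ (𝕍 ≠ ∅ → ∃ d, ∀ v, ∃ negative a_v, ∃ b ∈ lifts (d, −1), a_v ≫ φ = φ ≫ b)`;
* `Ex63.negCompatModel_iff_forall_isoTorsor_and_phiEllSync` — (β) is EXACTLY Prop 6.6 (ii) (all pairs) plus
  the synchronisation law (α) = `Ex63.PhiEllSync` of Example 6.3 (i) (`l` an odd prime);
* `exists_kit_forall_isoTorsor_not_negCompatModel` — **separation**: over abc-iut-L5-t13's one-place
  TRANSLATED toy kit (`φ^{Θell}_{•,v} = (z ↦ z + 1)` in `AGL₁(𝔽_l)`) the twisted form holds with `d = 2`, so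
  Prop 6.6 (ii) holds for ALL pairs of `𝒟-Θ^{ell}`-bridges and Prop 6.8 (i) for all `𝒟-Θ^{±ell}`-Hodge theaters,
  while (α), (β) and the literal equivariance of Example 6.3 (ii) at `γ = (0, −1)` all FAIL there.

CONSEQUENCE recorded for the branch-C certificates (`Summits/ABC/IUTFork/Conditional/Layer5OfS*.lean`,
`layer5_held_sec6 (hβ : Ex63.NegCompatModel K)`): for the Prop 6.6 (ii) / Prop 6.8 (i) conjuncts ALONE the
binder `hβ` is sufficient but NOT necessary — the necessary-and-sufficient binder is the twisted form above
(strictly weaker); `hβ` remains the right binder for the bundle because Prop 6.5 (i), second sentence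
(`XiGroupCompat`) needs (α), and (β) = twisted form ∧ (α).  No node token changes (NODE RULE: rows flip only on
theorems at the genuine kit).

Refuting / weakening a side condition over OUR interface `PMBaseKit` says nothing about the printed claim for the
genuine objects of [IUTchI] (where Example 6.3 (ii) supplies (β) with `d = 0`); nothing here takes a side on
[IUTchIII] Cor. 3.12 or asserts that abc is proved or refuted; typed ≠ proved; a FACT-LIST row is an assumption
label, proved/refuted = OUR kernel check only.
-/

namespace Literature.IUT.HodgeTheaters

open CategoryTheory

universe u

namespace PMBaseKit

variable {l : ℕ} {K : PMBaseKit.{u} l}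

namespace DThetaEllBridge

/-- **Prop 6.6 (ii) for the model bridge forces the twisted `[−1]`-compatibility** ([IUTchI] Ex 6.3 (i)
p. 161, Prop 6.6 (ii) p. 165, Def 6.4 (ii) p. 163): if the automorphisms of the model `𝒟-Θ^{ell}`-bridge
`φ^{Θell}_± : 𝔇_± → 𝒟^{⊚±}` of Example 6.3 (i) map ONTO the isomorphisms of `𝔽_l^±`-torsors `𝔽_l ⥲ 𝔽_l`, then for
ONE `d ∈ 𝔽_l` every `φ^{Θell}_{•,v}` intertwines a negative automorphism of `𝒟_v` with a lift of `(d, −1)`.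
The lift is `ψ ∘ (csp)` for the global constituent `ψ` of an automorphism with index bijection `t ↦ −t`, and
`d` is the fixed-chart value of `LabCusp^±(ψ)` at the class of chart-value `0`.
[claim: Mochizuki2012, status: disputed] -/
theorem twistedNegCompat_of_isoTorsor_model [NeZero l] (hV : Nonempty K.V)
    (h : IsoTorsor (Ex63.bridge K) (Ex63.bridge K)) :
    ∃ d : ZMod l, ∀ v, ∃ a : K.model v ≅ K.model v, K.labMap v a = labNeg (K.isLocal_model v) ∧
      ∃ b ∈ Ex63.lifts K (FlPM.mk d (-1)), a.hom ≫ K.phiEll v = K.phiEll v ≫ (K.atV v).map b.hom := by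
  classical
  obtain ⟨-, hbij⟩ := h hV
  -- `t ↦ −t` is an isomorphism of the (tautological) `𝔽_l^±`-torsor `T = 𝔽_l` of the model bridge
  have hnegc : (Ex63.bridge K).torT.Compat (Ex63.bridge K).torT (Equiv.neg (ZMod l)) := by
    change ∀ e ∈ (FlPMTorsor.tautological l).charts,
      (Equiv.neg (ZMod l)).trans e ∈ (FlPMTorsor.tautological l).charts
    rintro e ⟨g, rfl⟩
    refine ⟨g * FlPM.mk 0 (-1), ?_⟩
    ext z
    simp [FlPM.mk_smul, Units.neg_smul]
  obtain ⟨g, hg⟩ := hbij.2 ⟨Equiv.neg (ZMod l), hnegc⟩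
  have hκ : g.indexEquiv = Equiv.neg (ZMod l) := congrArg Subtype.val hg
  obtain ⟨ψ, hψ⟩ := g.globPoly_orbit
  obtain ⟨ψ, rfl⟩ : ∃ ψ' : Aut K.gModel, ψ' = ψ := ⟨ψ, rfl⟩
  have hψmem : ψ ∈ g.globPoly := by
    rw [hψ]
    exact ⟨1, one_mem _, (Iso.trans_refl _).symm⟩
  refine ⟨K.gChart₀ (K.gLabMap ψ (K.gChart₀.symm 0)), fun v => ?_⟩
  -- `φ_v` itself is a member of `φ^{Θell}_{v_0}`
  have h1 : (1 : Aut K.gModel) ∈ Ex63.lifts K (FlPM.transl 0) := by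
    rw [Ex63.lifts_transl_zero]; exact one_mem _
  have hf : K.phiEll v ∈ Ex63.poly K 0 v :=
    ⟨1, one_mem _, 1, h1, by change K.phiEll v = 𝟙 _ ≫ K.phiEll v ≫ (K.atV v).map (𝟙 _); simp⟩
  -- the bijection induced by `φ^{Θell}_{v_s}` is `LabCusp^±(b_s) ∘ (that of φ_v)`, `b_s` any lift of `s`
  have hζval : ∀ (s : ZMod l) (ζ : K.LabCuspPM v (K.model v) ≃ K.GLab K.gModel),
      (Ex63.bridge K).ZetaSpec s v ζ → ∀ {bs : Aut K.gModel}, bs ∈ Ex63.lifts K (FlPM.transl s) →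
        ∀ x, ζ x = K.gLabMap bs (K.labOfHom v (K.phiEll v) x) := by
    intro s ζ hζ bs hbs x
    have hfs : K.phiEll v ≫ (K.atV v).map bs.hom ∈ (Ex63.bridge K).poly s v :=
      ⟨1, one_mem _, bs, hbs, by change _ = 𝟙 _ ≫ _; exact (Category.id_comp _).symm⟩
    have this : K.labOfHom v (K.phiEll v ≫ (K.atV v).map bs.hom) x = ζ x := congrFun (hζ.1 _ hfs) x
    rw [K.labOfHom_post] at this
    exact this.symm
  -- read the compatibility square of `g` at `(0, v)` on the member `φ_v ≫ ψ`
  have hmem : K.phiEll v ≫ (K.atV v).map ψ.hom ∈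
      {h | ∃ p ∈ g.capsPoly (0 : ZMod l), ∃ g₂ ∈ (Ex63.bridge K).poly (g.indexEquiv (0 : ZMod l)) v,
        h = (p v).hom ≫ g₂} := by
    rw [g.compat (0 : ZMod l) v]
    exact ⟨K.phiEll v, hf, ψ, hψmem, rfl⟩
  obtain ⟨p, -, g₂, hg₂, heq⟩ := hmem
  -- normalise the types of the constituents (the capsule members of the model bridge ARE the `𝒟_v`)
  obtain ⟨pv, g₂, hg₂, heq⟩ : ∃ (pv : K.model v ≅ K.model v) (f : K.model v ⟶ (K.atV v).obj K.gModel),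
      f ∈ Ex63.poly K (g.indexEquiv (0 : ZMod l)) v ∧ K.phiEll v ≫ (K.atV v).map ψ.hom = pv.hom ≫ f :=
    ⟨p v, g₂, hg₂, heq⟩
  have hidx0 : g.indexEquiv (0 : ZMod l) = (0 : ZMod l) := by
    rw [hκ]; exact (congrFun (Equiv.neg_apply (ZMod l)) 0).trans neg_zero
  have hκ1 : g.indexEquiv (1 : ZMod l) = (-1 : ZMod l) := by
    rw [hκ]; exact congrFun (Equiv.neg_apply (ZMod l)) 1
  rw [hidx0] at hg₂
  obtain ⟨a', -, b', hb', rfl⟩ := hg₂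
  rw [Ex63.lifts_transl_zero] at hb'
  -- the automorphism `n := p_v ≫ a'` of `𝒟_v` and the global `ψ ≫ b'⁻¹`
  let n : K.model v ≅ K.model v := pv ≪≫ a'
  have hn : n.hom ≫ K.phiEll v = K.phiEll v ≫ (K.atV v).map (ψ ≪≫ b'.symm).hom := by
    have h2 := heq =≫ (K.atV v).map b'.inv
    simp only [Category.assoc, Iso.map_hom_inv_id, Category.comp_id] at h2
    show (pv ≪≫ a').hom ≫ K.phiEll v = K.phiEll v ≫ (K.atV v).map (ψ ≪≫ b'.symm).hom
    rw [Iso.trans_hom, Iso.trans_hom, Iso.symm_hom, Functor.map_comp, Category.assoc]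
    exact h2.symm
  -- the square on `±`-label classes of cusps
  have hsq := Ex63.labOfHom_phiEll_comp_labMap hn
  have hb'1 : K.gLabMap b' = Equiv.refl _ := MonoidHom.mem_ker.mp hb'
  have hgl : K.gLabMap (ψ ≪≫ b'.symm) = K.gLabMap ψ := by
    rw [K.gLabMap_trans, gLabMap_symm, hb'1]
    ext y
    rfl
  rw [hgl] at hsq
  set S := K.labPM v (K.model v) (K.isLocal_model v) with hS
  rcases labMap_eq_refl_or_labNeg (K.isLocal_model v) n with hn0 | hn0
  · -- `n` positive: then `LabCusp^±(ψ)` is trivial, and the square of `g` at `t = 1` reads `1 = −1`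
    exfalso
    have hψid : ∀ y, K.gLabMap ψ y = y := fun y => by
      obtain ⟨x, rfl⟩ := (K.labOfHom_phiEll_bijective v).2 y
      have := congrFun hsq x
      simp only [Function.comp_apply, hn0, Equiv.refl_apply] at this
      exact this.symm
    obtain ⟨φ1, hφ1⟩ := g.capsPoly_plusFull (1 : ZMod l)
    obtain ⟨ζ₁, hζ₁⟩ : ∃ ζ : K.LabCuspPM v (K.model v) ≃ K.GLab K.gModel,
        (Ex63.bridge K).ZetaSpec (1 : ZMod l) v ζ := (Ex63.bridge K).inducesZeta (1 : ZMod l) v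
    obtain ⟨ζ₂, hζ₂⟩ : ∃ ζ : K.LabCuspPM v (K.model v) ≃ K.GLab K.gModel,
        (Ex63.bridge K).ZetaSpec (g.indexEquiv (1 : ZMod l)) v ζ :=
      (Ex63.bridge K).inducesZeta (g.indexEquiv (1 : ZMod l)) v
    obtain ⟨b₁, hb₁⟩ := Ex63.lifts_nonempty (K := K) (FlPM.transl 1)
    obtain ⟨b₂, hb₂⟩ := Ex63.lifts_nonempty (K := K) (FlPM.transl (g.indexEquiv (1 : ZMod l)))
    let φv : K.model v ≅ K.model v := φ1 v
    have hz : ∀ x : K.LabCuspPM v (K.model v), K.gLabMap ψ (ζ₁ x) = ζ₂ (K.labMap v φv x) :=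
      fun x => DFunLike.congr_fun (g.zeta_trans_gLabMap (1 : ZMod l) v hφ1 hψmem hζ₁ hζ₂) x
    -- a label class fixed by `LabCusp^±(φ_v)`: the class of chart-value `0`
    have hxfix : K.labMap v φv (S.chart₀.symm 0) = S.chart₀.symm 0 := by
      rcases labMap_eq_refl_or_labNeg (K.isLocal_model v) φv with h0 | h0
      · rw [h0]; rfl
      · rw [h0]; simp [labNeg, hS]
    have hzx : ζ₁ (S.chart₀.symm 0) = ζ₂ (S.chart₀.symm 0) := by
      have := hz (S.chart₀.symm 0)
      rwa [hψid, hxfix] at this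
    -- in the fixed chart: `G + 1 = G + (−1)`
    have key := congrArg K.gChart₀ hzx
    rw [hζval 1 ζ₁ hζ₁ hb₁, hζval (g.indexEquiv (1 : ZMod l)) ζ₂ hζ₂ hb₂,
      ((Ex63.mem_lifts_iff_gChart₀ _ _).mp hb₁).2, ((Ex63.mem_lifts_iff_gChart₀ _ _).mp hb₂).2,
      FlPM.transl_smul, FlPM.transl_smul, hκ1, add_right_inj] at key
    exact two_ne_zero_of_isLocal (K.isLocal_model v) (by linear_combination key)
  · -- `n` negative: `ψ ≫ b'⁻¹` is a lift of `(d, −1)`, `d` read off `LabCusp^±(ψ)` in the fixed chart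
    have hψlam : ∀ x, K.gLabMap ψ (K.labOfHom v (K.phiEll v) x) =
        K.labOfHom v (K.phiEll v) (labNeg (K.isLocal_model v) x) := fun x => by
      have := congrFun hsq x
      simp only [Function.comp_apply, hn0] at this
      exact this.symm
    -- the chart `S.chart₀` pulled back along `φ_v` is `γ₀`-affine relative to the fixed chart
    obtain ⟨γ₀, hγ₀⟩ := K.gLabT.exists_of_mem K.gChart₀_mem
      (K.labOfHom_phiEll_charts v S.chart₀ S.chart₀_mem)
    have hE : ∀ x, S.chart₀ x = γ₀ • K.gChart₀ (K.labOfHom v (K.phiEll v) x) := fun x => by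
      have := congrArg (fun f => f (Equiv.ofBijective _ (K.labOfHom_phiEll_bijective v) x)) hγ₀
      simpa using this
    have hN : ∀ x, S.chart₀ (labNeg (K.isLocal_model v) x) = -S.chart₀ x := fun x => by
      simp [labNeg, hS]
    -- `LabCusp^±(ψ)` in the fixed chart: `G ↦ −G + dv`
    set dv : ZMod l := -(γ₀.right • (γ₀.left.toAdd + γ₀.left.toAdd)) with hdv
    have hform : ∀ x, K.gChart₀ (K.labOfHom v (K.phiEll v) (labNeg (K.isLocal_model v) x)) +
        K.gChart₀ (K.labOfHom v (K.phiEll v) x) = dv := fun x => by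
      have h := hN x
      rw [hE, hE, FlPM.smul_def, FlPM.smul_def] at h
      rw [hdv]
      rcases Int.units_eq_one_or γ₀.right with h1 | h1 <;> rw [h1] at h ⊢
      · simp only [one_smul] at h ⊢
        linear_combination h
      · simp only [Units.neg_smul, one_smul] at h ⊢
        linear_combination -h
    have hψG : ∀ y, K.gChart₀ (K.gLabMap ψ y) = -K.gChart₀ y + dv := fun y => by
      obtain ⟨x, rfl⟩ := (K.labOfHom_phiEll_bijective v).2 y
      rw [hψlam]
      linear_combination hform x
    have hd : K.gChart₀ (K.gLabMap ψ (K.gChart₀.symm 0)) = dv := by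
      rw [hψG, Equiv.apply_symm_apply, neg_zero, zero_add]
    -- `ψ ∈ Aut_±(𝒟^{⊚±})`: its action on `±`-label classes is in `Aut_±` of the torsor (clause `gLab_range`)
    have hψPM' : (K.gLabMap ψ : Equiv.Perm (K.GLab K.gModel)) ∈ K.gLabT.autPM := by
      rw [FlPMTorsor.mem_autPM_iff_exists]
      refine ⟨K.gChart₀, K.gChart₀_mem, FlPM.mk dv (-1), fun y => ?_⟩
      rw [hψG, FlPM.mk_smul, Units.neg_smul, one_smul]
    obtain ⟨α, hα1, hα2⟩ := (K.gLab_range _).mp hψPM'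
    have hψPM : ψ ∈ K.autPMg K.gModel := by
      have hcsp : (ψ ≪≫ α.symm : Aut K.gModel) ∈ K.autCsp K.gModel := by
        show K.gLabMap (ψ ≪≫ α.symm) = Equiv.refl _
        rw [K.gLabMap_trans, gLabMap_symm, hα2, Equiv.self_trans_symm]
      have hαPM : α ∈ K.autPMg K.gModel := (K.mem_autPMg_iff α).mpr hα1
      have h3 := (K.autPMg K.gModel).mul_mem hαPM (K.autCsp_le_autPMg _ hcsp)
      have h4 : (ψ ≪≫ α.symm) ≪≫ α = ψ := by
        rw [Iso.trans_assoc, Iso.symm_self_id, Iso.trans_refl]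
      rwa [Aut.Aut_mul_def, h4] at h3
    have hψlift : ψ ∈ Ex63.lifts K (FlPM.mk (K.gChart₀ (K.gLabMap ψ (K.gChart₀.symm 0))) (-1)) := by
      refine (Ex63.mem_lifts_iff_gChart₀ _ _).mpr ⟨hψPM, fun y => ?_⟩
      rw [hd, hψG, FlPM.mk_smul, Units.neg_smul, one_smul]
    have hb'symm : b'.symm ∈ K.autCsp K.gModel := (K.autCsp K.gModel).inv_mem hb'
    exact ⟨n, hn0, ψ ≪≫ b'.symm, Ex63.trans_csp_mem_lifts hψlift hb'symm, hn⟩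

/-- **[IUTchI] Prop 6.6 (ii) over a kit — the EXACT side condition** (p. 165; FACT-LIST F-2018 (ii)):
`DThetaEllBridge.IsoTorsor B₁ B₂` holds for ALL pairs of `𝒟-Θ^{ell}`-bridges over `K` iff (vacuously `𝕍 = ∅`, or)
for ONE `d ∈ 𝔽_l` every `φ^{Θell}_{•,v}` intertwines some negative automorphism of `𝒟_v` with a lift of
`(d, −1) ∈ 𝔽_l^{⋊±}` — the TWISTED `[−1]`-compatibility; (β) = `Ex63.NegCompatModel K` is its case `d = 0`.
[claim: Mochizuki2012, status: disputed] -/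
theorem forall_isoTorsor_iff_twistedNegCompat [NeZero l] :
    (∀ B₁ B₂ : K.DThetaEllBridge, IsoTorsor B₁ B₂) ↔
      (Nonempty K.V → ∃ d : ZMod l, ∀ v, ∃ a : K.model v ≅ K.model v,
        K.labMap v a = labNeg (K.isLocal_model v) ∧
          ∃ b ∈ Ex63.lifts K (FlPM.mk d (-1)), a.hom ≫ K.phiEll v = K.phiEll v ≫ (K.atV v).map b.hom) :=
  ⟨fun h hV => twistedNegCompat_of_isoTorsor_model hV (h _ _),
    fun h B₁ B₂ hV => by
      obtain ⟨d, hd⟩ := h hV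
      exact isoTorsor_of_twistedNegCompat hd B₁ B₂ hV⟩

/-- **Prop 6.6 (ii) for the single pair (model bridge, model bridge) already gives it for all pairs**
([IUTchI] Prop 6.6 (ii) p. 165; the model bridge of Example 6.3 (i)). [claim: Mochizuki2012, status: disputed] -/
theorem isoTorsor_of_isoTorsor_model [NeZero l] (h : IsoTorsor (Ex63.bridge K) (Ex63.bridge K))
    (B₁ B₂ : K.DThetaEllBridge) : IsoTorsor B₁ B₂ := fun hV => by
  obtain ⟨d, hd⟩ := twistedNegCompat_of_isoTorsor_model hV h
  exact isoTorsor_of_twistedNegCompat hd B₁ B₂ hV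

end DThetaEllBridge

namespace Ex63

/-- **(β) = Prop 6.6 (ii) + (α)** ([IUTchI] Ex 6.3 (i), (ii) pp. 160–161, Prop 6.6 (ii) p. 165), `l` an odd
prime: the `[−1]`-compatibility `Ex63.NegCompatModel K` holds iff `DThetaEllBridge.IsoTorsor` holds for all
pairs of `𝒟-Θ^{ell}`-bridges AND the synchronisation law `Ex63.PhiEllSync K` holds.  (`→`: abc-iut-L5-t13 /
abc-iut-w5-d086 and `phiEllSync_of_negCompatModel`; `←`: the twist `d` of
`twistedNegCompat_of_isoTorsor_model` is twice the asynchrony of `φ^{Θell}_{•,v}`, which (α) kills.)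
[claim: Mochizuki2012, status: disputed] -/
theorem negCompatModel_iff_forall_isoTorsor_and_phiEllSync [Fact l.Prime] (hl : l ≠ 2) :
    NegCompatModel K ↔
      (∀ B₁ B₂ : K.DThetaEllBridge, DThetaEllBridge.IsoTorsor B₁ B₂) ∧ PhiEllSync K := by
  haveI : NeZero l := ⟨(Fact.out : l.Prime).ne_zero⟩
  constructor
  · exact fun h => ⟨DThetaEllBridge.isoTorsor_of_negCompatModel h, phiEllSync_of_negCompatModel hl h⟩
  · rintro ⟨hiso, hsync⟩ v
    obtain ⟨d, hd⟩ := DThetaEllBridge.twistedNegCompat_of_isoTorsor_model ⟨v⟩ (hiso _ _)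
    obtain ⟨a, ha, b, hb, hab⟩ := hd v
    suffices hd0 : d = 0 by
      subst hd0
      exact ⟨a, ha, b, hb, hab⟩
    -- under (α) the twist vanishes
    set S := K.labPM v (K.model v) (K.isLocal_model v) with hS
    obtain ⟨ε, hε⟩ := hsync v S.chart₀ S.chart₀_mem
    have hE : ∀ x, S.chart₀ x = ε • K.gChart₀ (K.labOfHom v (K.phiEll v) x) := fun x => by
      have := congrArg (fun f => f (Equiv.ofBijective _ (K.labOfHom_phiEll_bijective v) x)) hε
      simpa using this
    have hN : ∀ x, S.chart₀ (labNeg (K.isLocal_model v) x) = -S.chart₀ x := fun x => by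
      simp [labNeg, hS]
    have hsq := labOfHom_phiEll_comp_labMap hab
    rw [ha] at hsq
    have h1 : K.gChart₀ (K.labOfHom v (K.phiEll v) (labNeg (K.isLocal_model v) (S.chart₀.symm 0))) =
        -K.gChart₀ (K.labOfHom v (K.phiEll v) (S.chart₀.symm 0)) + d := by
      have := congrFun hsq (S.chart₀.symm 0)
      simp only [Function.comp_apply] at this
      rw [this, ((mem_lifts_iff_gChart₀ _ _).mp hb).2, FlPM.mk_smul, Units.neg_smul, one_smul]
    have h2 := hN (S.chart₀.symm 0)
    rw [hE, hE, h1] at h2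
    rcases Int.units_eq_one_or ε with h3 | h3 <;> rw [h3] at h2
    · simp only [one_smul] at h2
      linear_combination h2
    · simp only [Units.neg_smul, one_smul] at h2
      linear_combination -h2

end Ex63

/-! ### Separation: Prop 6.6 (ii) holds over a kit where (α), (β) and Ex 6.3 (ii) at `(0, −1)` fail -/

/-- **Prop 6.6 (ii) over a kit is STRICTLY weaker than (β)** (explicit kit, universe `0`): over
abc-iut-L5-t13's one-place translated toy kit — abc-iut-L5-t4's collage kit with `φ^{Θell}_{•,v}` the
TRANSLATION `z ↦ z + 1` of `AGL₁(𝔽_l)` (the kit of `Ex63.exists_kit_not_equivariant` /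
`Ex63.exists_kit_not_phiEllSync`, rebuilt verbatim; every interface clause genuine) — the twisted
`[−1]`-compatibility holds with `d = 2` (the negative automorphism `−1` of `𝒟_v` against the lift `z ↦ −z + 2`),
hence [IUTchI] Prop 6.6 (ii) holds for ALL pairs of `𝒟-Θ^{ell}`-bridges and Prop 6.8 (i) for ALL
`𝒟-Θ^{±ell}`-Hodge theaters, while the synchronisation law (α), the `[−1]`-compatibility (β) =
`Ex63.NegCompatModel`, and the literal equivariance of Example 6.3 (ii) at `γ = (0, −1)` all FAIL.
[claim: Mochizuki2012, status: disputed] -/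
theorem exists_kit_forall_isoTorsor_not_negCompatModel (l : ℕ) [Fact l.Prime] (hl : l ≠ 2) :
    ∃ K : PMBaseKit.{0} l, Nonempty K.V ∧
      (∀ B₁ B₂ : K.DThetaEllBridge, DThetaEllBridge.IsoTorsor B₁ B₂) ∧
      (∀ H : K.DThetaPMEllHT, DThetaPMEllHT.EllBridgeSymmetry H) ∧
      ¬ Ex63.PhiEllSync K ∧ ¬ Ex63.NegCompatModel K ∧ ¬ Ex63.Equivariant K (FlPM.mk 0 (-1)) := by
  classical
  -- the translation `z ↦ z + 1` of `AGL₁(𝔽_l)` (as in `Ex63.exists_kit_not_equivariant`)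
  let φ₁ : Model.AGL l := ⟨Multiplicative.ofAdd 1, 1⟩
  have hφ₁ : ∀ z : ZMod l, Model.aglPerm l φ₁ z = z + 1 := fun z => by
    change ((1 : (ZMod l)ˣ) : ZMod l) * z + (Multiplicative.ofAdd (1 : ZMod l)).toAdd = z + 1
    simp
  let K : PMBaseKit.{0} l :=
    { PMBaseKit.toyKit l hl with
      phiEll := fun _ => φ₁
      labOfHom_phiEll_bijective := fun _ => (Model.homPerm l (X := .loc) (Y := .glob) φ₁).bijective
      labOfHom_phiEll_charts := by
        rintro _ e ⟨ε, rfl⟩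
        refine ⟨FlPM.mk (-(ε • (1 : ZMod l))) ε, ?_⟩
        ext z
        change (FlPM.mk (l := l) _ ε) • z = ε • (Equiv.ofBijective _ _).symm z
        generalize hw : (Equiv.ofBijective _ _).symm z = w
        rw [Equiv.symm_apply_eq] at hw
        change z = Model.homPerm l (X := .loc) (Y := .glob) φ₁ w at hw
        have hw' : z = w + 1 := by rw [hw]; exact hφ₁ w
        subst hw'
        simp only [FlPM.mk_smul, smul_add]
        abel }
  have hV : Nonempty K.V := ⟨(show K.V from ())⟩
  have hchart : ∀ z : ZMod l, K.gChart₀ z = z := fun z => by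
    change FlPM.toPerm l 1 z = z
    simp
  have hchart' : ∀ z : ZMod l, K.gChart₀.symm z = z := fun z => by
    rw [Equiv.symm_apply_eq]; exact (hchart z).symm
  -- the twisted `[−1]`-compatibility with `d = 2`
  have htw : ∀ v, ∃ a : K.model v ≅ K.model v, K.labMap v a = labNeg (K.isLocal_model v) ∧
      ∃ b ∈ Ex63.lifts K (FlPM.mk 2 (-1)), a.hom ≫ K.phiEll v = K.phiEll v ≫ (K.atV v).map b.hom := by
    intro v
    -- the negative automorphism `−1` of the local object
    let a : K.model v ≅ K.model v :=
      ⟨(-1 : ℤˣ), (-1 : ℤˣ), by change (-1 : ℤˣ) * (-1) = 1; simp, by change (-1 : ℤˣ) * (-1) = 1; simp⟩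
    -- the affine map `z ↦ −z + 2` of the global object
    let β : Model.AGL l := ⟨Multiplicative.ofAdd 2, -1⟩
    have hββ : β * β = 1 := by
      refine SemidirectProduct.ext ?_ ?_
      · change Multiplicative.ofAdd (2 : ZMod l) * Multiplicative.ofAdd (((-1 : (ZMod l)ˣ) : ZMod l) * 2) = 1
        rw [← ofAdd_add]
        simp
      · change (-1 : (ZMod l)ˣ) * (-1) = 1
        simp
    have hβz : ∀ z : ZMod l, Model.aglPerm l β z = -z + 2 := fun z => by
      change ((-1 : (ZMod l)ˣ) : ZMod l) * z + (Multiplicative.ofAdd (2 : ZMod l)).toAdd = -z + 2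
      simp
    let b : Aut K.gModel := ⟨β, β, by change β * β = 1; exact hββ, by change β * β = 1; exact hββ⟩
    have hneg : ∀ z : ZMod l, labNeg (K.isLocal_model v) z = -z := by
      intro z
      obtain ⟨ε, hε⟩ : ∃ ε : ℤˣ, signPerm l ε = (K.labPM v (K.model v) (K.isLocal_model v)).chart₀ :=
        (K.labPM v (K.model v) (K.isLocal_model v)).chart₀_mem
      change ((K.labPM v (K.model v) (K.isLocal_model v)).chart₀.trans ((signPerm l (-1)).trans
        (K.labPM v (K.model v) (K.isLocal_model v)).chart₀.symm)) z = -z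
      rw [← hε]
      change (signPerm l ε).symm (signPerm l (-1) (signPerm l ε z)) = -z
      rw [Equiv.symm_apply_eq]
      simp [Units.smul_def, smul_neg]
    refine ⟨a, ?_, b, ?_, ?_⟩
    · ext z
      change signPerm l (-1) z = labNeg (K.isLocal_model v) z
      rw [hneg, signPerm_apply, Units.neg_smul, one_smul]
    · refine (Ex63.mem_lifts_iff_gChart₀ _ _).mpr ⟨?_, fun y => ?_⟩
      · rw [K.mem_autPMg_iff]
        change QuotientGroup.mk' _ (SemidirectProduct.rightHom β) = 1
        rw [QuotientGroup.mk'_apply, QuotientGroup.eq_one_iff, mem_unitsPlusMinus_iff]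
        exact Or.inr rfl
      · obtain ⟨z, rfl⟩ : ∃ z : ZMod l, K.gChart₀.symm z = y := ⟨K.gChart₀ y, K.gChart₀.symm_apply_apply y⟩
        rw [hchart' z]
        change K.gChart₀ (Model.aglPerm l β z) = _
        rw [hβz, hchart, hchart, FlPM.mk_smul, Units.neg_smul, one_smul]
    · change φ₁ * Model.signToAGL l (-1) = β * φ₁
      refine SemidirectProduct.ext ?_ ?_
      · change Multiplicative.ofAdd (1 : ZMod l) *
            Multiplicative.ofAdd (((1 : (ZMod l)ˣ) : ZMod l) * (Model.signToAGL l (-1)).left.toAdd) =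
          Multiplicative.ofAdd (2 : ZMod l) * Multiplicative.ofAdd (((-1 : (ZMod l)ˣ) : ZMod l) * 1)
        have h0 : (Model.signToAGL l (-1)).left = 1 := rfl
        rw [h0, ← ofAdd_add, ← ofAdd_add]
        congr 1
        simp only [toAdd_one, mul_zero, add_zero, Units.val_neg, Units.val_one, mul_one]
        norm_num
      · change (1 : (ZMod l)ˣ) * (Model.signToAGL l (-1)).right = -1 * 1
        rw [one_mul, mul_one]
        change Units.map (Int.castRingHom (ZMod l)).toMonoidHom (-1) = -1
        ext
        simp
  -- the synchronisation law (α) fails: the chart `id` pulls back along `z ↦ z + 1` to `z ↦ z − 1`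
  have hnsync : ¬ Ex63.PhiEllSync K := by
    intro hS
    obtain ⟨v⟩ := hV
    have hmem : signPerm l 1 ∈ (K.labPM v (K.model v) ⟨Iso.refl _⟩).charts := ⟨1, rfl⟩
    obtain ⟨ε, hε⟩ := hS v (signPerm l 1) hmem
    have hsymm : (Equiv.ofBijective _ (K.labOfHom_phiEll_bijective v)).symm (1 : ZMod l) = (0 : ZMod l) := by
      rw [Equiv.symm_apply_eq]
      change (1 : ZMod l) = Model.aglPerm l φ₁ 0
      rw [hφ₁, zero_add]
    have h1 := Equiv.congr_fun hε (1 : ZMod l)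
    change (signPerm l 1 : Equiv.Perm (ZMod l))
        (((Equiv.ofBijective _ (K.labOfHom_phiEll_bijective v)).symm (1 : ZMod l) : ZMod l)) =
      (signPerm l ε : Equiv.Perm (ZMod l)) ((K.gChart₀ (1 : ZMod l) : ZMod l)) at h1
    rw [hsymm, hchart, signPerm_apply, signPerm_apply, smul_zero] at h1
    have h10 : (1 : ZMod l) = 0 := by
      rcases Int.units_eq_one_or ε with rfl | rfl
      · rw [one_smul] at h1
        exact h1.symm
      · rw [Units.neg_smul, one_smul] at h1
        have h1' := congrArg Neg.neg h1
        rw [neg_neg, neg_zero] at h1'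
        exact h1'.symm
    have hprime : l.Prime := Fact.out
    have hl1 : l ∣ 1 := (ZMod.natCast_eq_zero_iff 1 l).mp (by exact_mod_cast h10)
    exact hprime.one_lt.ne' (Nat.dvd_one.mp hl1)
  refine ⟨K, hV, fun B₁ B₂ => DThetaEllBridge.isoTorsor_of_twistedNegCompat htw B₁ B₂,
    fun H => DThetaPMEllHT.ellBridgeSymmetry_of_twistedNegCompat htw H, hnsync,
    fun hN => hnsync (Ex63.phiEllSync_of_negCompatModel hl hN),
    fun hE => hnsync (Ex63.phiEllSync_of_negCompatModel hl (Ex63.negCompatModel_of_equivariant hE))⟩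

/-- **F-2018 (ii) — exact-side-condition verdict, assembled** ([IUTchI] Prop 6.6 (ii) p. 165): over every kit
(`l ≠ 0`) Prop 6.6 (ii) for all pairs is EQUIVALENT to the twisted `[−1]`-compatibility; (β) implies it; and
for every odd prime `l` some kit has it WITHOUT (β).  [claim: Mochizuki2012, status: disputed] -/
theorem DThetaEllBridge.isoTorsor_exact_side_condition_verdict :
    (∀ (l : ℕ) [NeZero l] (K : PMBaseKit.{u} l),
      (∀ B₁ B₂ : K.DThetaEllBridge, DThetaEllBridge.IsoTorsor B₁ B₂) ↔
        (Nonempty K.V → ∃ d : ZMod l, ∀ v, ∃ a : K.model v ≅ K.model v,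
          K.labMap v a = labNeg (K.isLocal_model v) ∧
            ∃ b ∈ Ex63.lifts K (FlPM.mk d (-1)), a.hom ≫ K.phiEll v = K.phiEll v ≫ (K.atV v).map b.hom)) ∧
    (∀ (l : ℕ) (K : PMBaseKit.{u} l), Ex63.NegCompatModel K →
      ∀ B₁ B₂ : K.DThetaEllBridge, DThetaEllBridge.IsoTorsor B₁ B₂) ∧
    (∀ (l : ℕ) [Fact l.Prime], l ≠ 2 → ∃ K : PMBaseKit.{0} l, Nonempty K.V ∧
      (∀ B₁ B₂ : K.DThetaEllBridge, DThetaEllBridge.IsoTorsor B₁ B₂) ∧ ¬ Ex63.NegCompatModel K) :=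
  ⟨fun _ _ _ => DThetaEllBridge.forall_isoTorsor_iff_twistedNegCompat,
    fun _ _ h => DThetaEllBridge.isoTorsor_of_negCompatModel h,
    fun l _ hl => by
      obtain ⟨K, hV, hiso, -, -, hN, -⟩ := exists_kit_forall_isoTorsor_not_negCompatModel l hl
      exact ⟨K, hV, hiso, hN⟩⟩

end PMBaseKit

end Literature.IUT.HodgeTheaters
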